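import Literature.NumberTheory.GaloisRepresentations.RayClassGroupFinite
import Literature.NumberTheory.LFunctions.PrimesInRayClasses
import HarnessLib

/-!
# The ray-class dévissage `(𝓞/𝔪)ˣ → Cl_K^𝔪 → Cl_K → 1` in dual form (Road A, step A4, of Stub H)

Summit `BirchSwinnertonDyer`, crux `PrintCFram.BottomClassIndexLawFiveLe` (stmt-BirchSwinnertonDyer-20372), line
`eisenstein-resource-bdp-line`, Stub H′ `stub_homVanishing_of_bernoulliPair` (registry v11).  Width seat
`bsd-line-cfram-p1-w4` g5, typing item «A4-engine» of the LEAD g8 report §4 (Road A): «(A4) IN DUAL FORM (no exact-sequence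
typing): a character of `Cl_L^𝔪` killing `p` restricts to `ker(Cl^𝔪 → Cl) ≅ (𝓞_L/𝔪)^×/𝓞_L^×`».  HONEST FRAMING: generic
algebraic number theory (Neukirch VI (1.11) in the tree's currency); no summit statement is proved here, no stub is closed.

CURRENCY (the tree's, definition-free here): `RayClassGroup 𝔪 = J_K^𝔪 / P_K^𝔪` (narrow ray class group,
`GaloisRepresentations/RayClassGroup.lean`), `integralRayClass 𝔪 h𝔪 𝔞` (the class of a nonzero integral ideal prime to `𝔪`,
`𝔞 : LFunctions.CoprimeIdeal 𝔪 = {𝔞 // 𝔞 ≠ ⊥ ∧ IsCoprime 𝔞 𝔪}`), `CoprimeIdeal.idealClass 𝔞 = ClassGroup.mk0 𝔞`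
(`LFunctions/RayClasses.lean`), and the Galois action `ClassGroup.mulEquiv (AmbiguousClass.intAut σ)` /
`classGroupRep F K σ` (`NumberFields/ClassGroupUnitsGaloisModules.lean`).  A nonzero `a ∈ 𝓞 K` prime to `𝔪` is carried as
`(a : 𝓞 K) (ha : Ideal.span {a} ≠ ⊥ ∧ IsCoprime (Ideal.span {a}) 𝔪)`, so that `⟨Ideal.span {a}, ha⟩ : CoprimeIdeal 𝔪`;
the two homomorphisms of the dévissage are EXISTENTIALS pinned down by their values (no definition is introduced).

WHAT IS HERE (`K` a number field, `𝔪 ≠ 0` an ideal of `𝓞 K`, `G` a commutative group, `ψ : RayClassGroup 𝔪 →* G`):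
* §0 `isCoprime_span_singleton_iff_isUnit_mk` (`(a)` prime to `𝔪 ⟺ a` is a unit mod `𝔪`), `exists_lift_of_unit`
  (every unit mod `𝔪` lifts to a nonzero `a` prime to `𝔪`), `span_mul_ne_bot_and_isCoprime`, `span_unit_ne_bot_and_isCoprime`,
  `mul_ne_bot_and_isCoprime`.
* §1 principal classes: `integralRayClass_span_mul` (`[(ab)] = [(a)][(b)]`), `integralRayClass_span_unit` (`[(u)] = 1`),
  **`integralRayClass_span_eq_of_sub_mem`** (`K` totally complex: `a ≡ b mod 𝔪 ⟹ [(a)] = [(b)]`).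
* §2 the unit side (`K` totally complex): **`exists_unitsQuot_hom`** (`∃ η : (𝓞 K ⧸ 𝔪)ˣ →* RayClassGroup 𝔪` with
  `η (a mod 𝔪) = [(a)]`), **`exists_unitsQuot_character`** (`∃ η : (𝓞 K ⧸ 𝔪)ˣ →* G` with `η (a mod 𝔪) = ψ [(a)]`),
  `unitsQuot_character_map_units` (such an `η` kills the global units).
* §3 the class-group side: **`exists_coprimeIdeal_idealClass_eq`** (every ideal class contains an ideal prime to `𝔪`),
  `apply_integralRayClass_eq_of_idealClass_eq`, **`exists_classGroup_hom_of_forall_span`** (`ψ` kills every `[(a)]` ⟹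
  `ψ [𝔞] = ψ' (cl 𝔞)` for some `ψ' : ClassGroup (𝓞 K) →* G`), `apply_integralRayClass_span_eq_one_of_classGroup_hom`
  (converse), **`eq_one_of_unitsQuot_of_classGroup`** (the dévissage: if every such `η` and every such `ψ'` is trivial,
  `ψ = 1`).
* Galois transport (`ψ' (σ · C) = ψ' C ^ n`, equivariance of `η`) and the bridge to the `𝔽_p ⊗_ℤ Cl_K` currency of the
  T5 files: sequel `…HerbrandRayClassDevissageGalois.lean`.

References: J. Neukirch, *Algebraic Number Theory*, Ch. VI §1 (1.7)–(1.11) and Exercise 13 [NeukirchANT1999];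
S. Lang, *Algebraic Number Theory*, Ch. VI §1; the LEAD g8 report §4 (crux workfile `Lines/eisenstein-resource-bdp-line-lead-g8.md`).
-/

noncomputable section

-- summit-side namespace `Summit.BirchSwinnertonDyer.BirchSwinnertonDyer.…` (single-conjunct summit, D-0017 layout)
set_option linter.dupNamespace false
set_option autoImplicit false

open scoped Classical nonZeroDivisors
open NumberField IsDedekindDomain
open Literature.NumberTheory.GaloisRepresentations Literature.NumberTheory.LFunctions
namespace Summit.BirchSwinnertonDyer.BirchSwinnertonDyer.Theorems.PrintCFram.HerbrandRayClassDevissage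

variable {K : Type*} [Field K] [NumberField K] {𝔪 : Ideal (𝓞 K)}

/-! ### §0 Admissible elements: nonzero and prime to `𝔪` -/

omit [NumberField K] in
/-- `(a)` is prime to `𝔪` iff `a` is a unit mod `𝔪`. [folklore] -/
theorem isCoprime_span_singleton_iff_isUnit_mk (a : 𝓞 K) :
    IsCoprime (Ideal.span {a}) 𝔪 ↔ IsUnit (Ideal.Quotient.mk 𝔪 a) := by
  rw [Ideal.isCoprime_iff_exists]
  constructor
  · rintro ⟨i, hi, j, hj, hij⟩
    obtain ⟨r, rfl⟩ := Ideal.mem_span_singleton'.mp hi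
    refine isUnit_iff_exists_inv.mpr ⟨Ideal.Quotient.mk 𝔪 r, ?_⟩
    rw [← map_mul, ← (Ideal.Quotient.mk 𝔪).map_one, Ideal.Quotient.eq]
    have e : a * r - 1 = -j := by linear_combination hij
    rw [e]
    exact 𝔪.neg_mem hj
  · intro h
    obtain ⟨b, hb⟩ := h.exists_right_inv
    obtain ⟨r, rfl⟩ := Ideal.Quotient.mk_surjective b
    rw [← map_mul, ← (Ideal.Quotient.mk 𝔪).map_one, Ideal.Quotient.eq] at hb
    refine ⟨r * a, Ideal.mem_span_singleton'.mpr ⟨r, rfl⟩, 1 - r * a, ?_, by ring⟩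
    have e : 1 - r * a = -(a * r - 1) := by ring
    rw [e]
    exact 𝔪.neg_mem hb

omit [NumberField K] in
/-- For a nonzero `a`: `(a) ≠ 0` and `(a)` is prime to `𝔪` iff `a` is a unit mod `𝔪`. [folklore] -/
theorem span_ne_bot_and_isCoprime_iff {a : 𝓞 K} (ha0 : a ≠ 0) :
    (Ideal.span {a} ≠ ⊥ ∧ IsCoprime (Ideal.span {a}) 𝔪) ↔ IsUnit (Ideal.Quotient.mk 𝔪 a) := by
  rw [isCoprime_span_singleton_iff_isUnit_mk]
  exact ⟨fun h => h.2, fun h => ⟨mt Ideal.span_singleton_eq_bot.mp ha0, h⟩⟩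

omit [NumberField K] in
/-- **Every unit mod `𝔪 ≠ 0` lifts to a nonzero `a ∈ 𝓞 K` prime to `𝔪`.** [folklore] -/
theorem exists_lift_of_unit (h𝔪 : 𝔪 ≠ ⊥) (x : (𝓞 K ⧸ 𝔪)ˣ) :
    ∃ a : 𝓞 K, (Ideal.span {a} ≠ ⊥ ∧ IsCoprime (Ideal.span {a}) 𝔪) ∧ Ideal.Quotient.mk 𝔪 a = x := by
  obtain ⟨a, ha⟩ := Ideal.Quotient.mk_surjective (x : 𝓞 K ⧸ 𝔪)
  by_cases ha0 : a = 0
  · obtain ⟨m, hm, hm0⟩ := Submodule.exists_mem_ne_zero_of_ne_bot h𝔪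
    have hmx : Ideal.Quotient.mk 𝔪 m = x := by
      rw [← ha, ha0, map_zero]
      exact Ideal.Quotient.eq_zero_iff_mem.mpr hm
    refine ⟨m, (span_ne_bot_and_isCoprime_iff hm0).mpr ?_, hmx⟩
    rw [hmx]
    exact x.isUnit
  · refine ⟨a, (span_ne_bot_and_isCoprime_iff ha0).mpr ?_, ha⟩
    rw [ha]
    exact x.isUnit

omit [NumberField K] in
/-- Products of admissible elements are admissible. [folklore] -/
theorem span_mul_ne_bot_and_isCoprime {a b : 𝓞 K} (ha : Ideal.span {a} ≠ ⊥ ∧ IsCoprime (Ideal.span {a}) 𝔪)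
    (hb : Ideal.span {b} ≠ ⊥ ∧ IsCoprime (Ideal.span {b}) 𝔪) :
    Ideal.span {a * b} ≠ ⊥ ∧ IsCoprime (Ideal.span {a * b}) 𝔪 := by
  rw [← Ideal.span_singleton_mul_span_singleton]
  exact ⟨mul_ne_zero ha.1 hb.1, IsCoprime.mul_left ha.2 hb.2⟩

omit [NumberField K] in
/-- Units are admissible. [folklore] -/
theorem span_unit_ne_bot_and_isCoprime (u : (𝓞 K)ˣ) :
    Ideal.span {(u : 𝓞 K)} ≠ ⊥ ∧ IsCoprime (Ideal.span {(u : 𝓞 K)}) 𝔪 := by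
  rw [Ideal.span_singleton_eq_top.mpr u.isUnit, ← Ideal.one_eq_top]
  exact ⟨one_ne_zero, isCoprime_one_left⟩

omit [NumberField K] in
/-- The product of two nonzero ideals prime to `𝔪` is one. [folklore] -/
theorem mul_ne_bot_and_isCoprime (𝔞 𝔟 : CoprimeIdeal 𝔪) :
    𝔞.1 * 𝔟.1 ≠ ⊥ ∧ IsCoprime (𝔞.1 * 𝔟.1) 𝔪 :=
  ⟨mul_ne_zero 𝔞.2.1 𝔟.2.1, IsCoprime.mul_left 𝔞.2.2 𝔟.2.2⟩

/-! ### §1 Principal classes -/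

/-- **`[(ab)] = [(a)] · [(b)]` in `Cl_K^𝔪`.** [cite: NeukirchANT1999, Ch. VI §1 Def. (1.7)] -/
theorem integralRayClass_span_mul (h𝔪 : 𝔪 ≠ ⊥) {a b : 𝓞 K}
    (ha : Ideal.span {a} ≠ ⊥ ∧ IsCoprime (Ideal.span {a}) 𝔪) (hb : Ideal.span {b} ≠ ⊥ ∧ IsCoprime (Ideal.span {b}) 𝔪)
    (hab : Ideal.span {a * b} ≠ ⊥ ∧ IsCoprime (Ideal.span {a * b}) 𝔪) :
    integralRayClass 𝔪 h𝔪 ⟨Ideal.span {a * b}, hab⟩ =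
      integralRayClass 𝔪 h𝔪 ⟨Ideal.span {a}, ha⟩ * integralRayClass 𝔪 h𝔪 ⟨Ideal.span {b}, hb⟩ := by
  rw [← integralRayClass_mul h𝔪 ⟨_, ha⟩ ⟨_, hb⟩ (mul_ne_bot_and_isCoprime ⟨_, ha⟩ ⟨_, hb⟩)]
  exact integralRayClass_congr h𝔪 (Ideal.span_singleton_mul_span_singleton a b).symm

/-- **`[(u)] = 1` for a unit `u`** (`(u) = (1)`). [cite: NeukirchANT1999, Ch. VI §1 Def. (1.7)] -/
theorem integralRayClass_span_unit (h𝔪 : 𝔪 ≠ ⊥) (u : (𝓞 K)ˣ)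
    (hu : Ideal.span {(u : 𝓞 K)} ≠ ⊥ ∧ IsCoprime (Ideal.span {(u : 𝓞 K)}) 𝔪) :
    integralRayClass 𝔪 h𝔪 ⟨Ideal.span {(u : 𝓞 K)}, hu⟩ = 1 := by
  have htop : Ideal.span {(u : 𝓞 K)} = ⊤ := Ideal.span_singleton_eq_top.mpr u.isUnit
  have h : (⊤ : Ideal (𝓞 K)) ≠ ⊥ ∧ IsCoprime (⊤ : Ideal (𝓞 K)) 𝔪 := by rw [← htop]; exact hu
  rw [integralRayClass_congr h𝔪 (𝔟 := ⟨⊤, h⟩) htop, integralRayClass_top]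

/-- **`a ≡ b mod 𝔪 ⟹ [(a)] = [(b)]` in the narrow ray class group of a TOTALLY COMPLEX `K`** (no sign condition):
`(a)(b) = (b)(a)` with `b ≡ a mod 𝔪`, `a` prime to `𝔪` is the relation `RayClassRel` of the tree.
[cite: NeukirchANT1999, Ch. VI §1 Prop. (1.9)] -/
theorem integralRayClass_span_eq_of_sub_mem [IsTotallyComplex K] (h𝔪 : 𝔪 ≠ ⊥) {a b : 𝓞 K}
    (ha : Ideal.span {a} ≠ ⊥ ∧ IsCoprime (Ideal.span {a}) 𝔪) (hb : Ideal.span {b} ≠ ⊥ ∧ IsCoprime (Ideal.span {b}) 𝔪)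
    (hab : a - b ∈ 𝔪) :
    integralRayClass 𝔪 h𝔪 ⟨Ideal.span {a}, ha⟩ = integralRayClass 𝔪 h𝔪 ⟨Ideal.span {b}, hb⟩ := by
  -- a totally complex field has no real embedding (tree: `isEmpty_ringHom_real_of_isTotallyComplex`, `BigHilbertClassField.lean`)
  haveI : IsEmpty (K →+* ℝ) := ⟨fun φ => IsTotallyComplex.complexEmbedding_not_isReal (Complex.ofRealHom.comp φ)
    (by rw [ComplexEmbedding.isReal_iff]; ext y; simp)⟩
  rw [integralRayClass_eq_iff h𝔪]
  refine ⟨b, a, fun h => hb.1 (Ideal.span_singleton_eq_bot.mpr h), fun h => ha.1 (Ideal.span_singleton_eq_bot.mpr h),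
    ha.2, ?_, fun φ => isEmptyElim φ, mul_comm _ _⟩
  rw [← neg_sub]
  exact 𝔪.neg_mem hab

/-! ### §2 The unit side: `(𝓞 K ⧸ 𝔪)ˣ → Cl_K^𝔪` -/

/-- **The homomorphism `(𝓞 K/𝔪)ˣ → Cl_K^𝔪`, `a mod 𝔪 ↦ [(a)]`** (totally complex `K`), as an existential pinned by
its values. [cite: NeukirchANT1999, Ch. VI §1 Prop. (1.11)] -/
theorem exists_unitsQuot_hom [IsTotallyComplex K] (h𝔪 : 𝔪 ≠ ⊥) :
    ∃ η : (𝓞 K ⧸ 𝔪)ˣ →* RayClassGroup 𝔪,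
      ∀ (x : (𝓞 K ⧸ 𝔪)ˣ) (a : 𝓞 K) (ha : Ideal.span {a} ≠ ⊥ ∧ IsCoprime (Ideal.span {a}) 𝔪),
        Ideal.Quotient.mk 𝔪 a = x → η x = integralRayClass 𝔪 h𝔪 ⟨Ideal.span {a}, ha⟩ := by
  choose lift hlift hmk using exists_lift_of_unit (K := K) h𝔪
  have hval : ∀ (x : (𝓞 K ⧸ 𝔪)ˣ) (a : 𝓞 K) (ha : Ideal.span {a} ≠ ⊥ ∧ IsCoprime (Ideal.span {a}) 𝔪),
      Ideal.Quotient.mk 𝔪 a = x →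
        integralRayClass 𝔪 h𝔪 ⟨Ideal.span {lift x}, hlift x⟩ = integralRayClass 𝔪 h𝔪 ⟨Ideal.span {a}, ha⟩ := by
    intro x a ha hax
    apply integralRayClass_span_eq_of_sub_mem h𝔪
    rw [← Ideal.Quotient.eq, hmk x, hax]
  refine ⟨MonoidHom.mk' (fun x => integralRayClass 𝔪 h𝔪 ⟨Ideal.span {lift x}, hlift x⟩) fun x y => ?_,
    fun x a ha hax => hval x a ha hax⟩
  have hxy : Ideal.Quotient.mk 𝔪 (lift x * lift y) = ((x * y : (𝓞 K ⧸ 𝔪)ˣ) : 𝓞 K ⧸ 𝔪) := by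
    rw [map_mul, hmk, hmk, Units.val_mul]
  change integralRayClass 𝔪 h𝔪 ⟨Ideal.span {lift (x * y)}, hlift (x * y)⟩ =
    integralRayClass 𝔪 h𝔪 ⟨Ideal.span {lift x}, hlift x⟩ * integralRayClass 𝔪 h𝔪 ⟨Ideal.span {lift y}, hlift y⟩
  rw [hval (x * y) (lift x * lift y) (span_mul_ne_bot_and_isCoprime (hlift x) (hlift y)) hxy]
  exact integralRayClass_span_mul h𝔪 (hlift x) (hlift y) _

/-- **The character `a mod 𝔪 ↦ ψ [(a)]` of `(𝓞 K/𝔪)ˣ`** induced by a character `ψ` of `Cl_K^𝔪` (totally complex `K`).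
[cite: NeukirchANT1999, Ch. VI §1 Prop. (1.11)] -/
theorem exists_unitsQuot_character [IsTotallyComplex K] (h𝔪 : 𝔪 ≠ ⊥) {G : Type*} [CommGroup G]
    (ψ : RayClassGroup 𝔪 →* G) :
    ∃ η : (𝓞 K ⧸ 𝔪)ˣ →* G,
      ∀ (x : (𝓞 K ⧸ 𝔪)ˣ) (a : 𝓞 K) (ha : Ideal.span {a} ≠ ⊥ ∧ IsCoprime (Ideal.span {a}) 𝔪),
        Ideal.Quotient.mk 𝔪 a = x → η x = ψ (integralRayClass 𝔪 h𝔪 ⟨Ideal.span {a}, ha⟩) := by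
  obtain ⟨η, hη⟩ := exists_unitsQuot_hom (K := K) h𝔪
  exact ⟨ψ.comp η, fun x a ha hax => by rw [MonoidHom.comp_apply, hη x a ha hax]⟩

/-- **Such a character kills the global units**: `η (u mod 𝔪) = ψ [(u)] = ψ 1 = 1`.
[cite: NeukirchANT1999, Ch. VI §1 Prop. (1.11)] -/
theorem unitsQuot_character_map_units (h𝔪 : 𝔪 ≠ ⊥) {G : Type*} [CommGroup G] (ψ : RayClassGroup 𝔪 →* G)
    (η : (𝓞 K ⧸ 𝔪)ˣ →* G)
    (hη : ∀ (x : (𝓞 K ⧸ 𝔪)ˣ) (a : 𝓞 K) (ha : Ideal.span {a} ≠ ⊥ ∧ IsCoprime (Ideal.span {a}) 𝔪),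
      Ideal.Quotient.mk 𝔪 a = x → η x = ψ (integralRayClass 𝔪 h𝔪 ⟨Ideal.span {a}, ha⟩))
    (u : (𝓞 K)ˣ) : η (Units.map (Ideal.Quotient.mk 𝔪 : 𝓞 K →* 𝓞 K ⧸ 𝔪) u) = 1 := by
  rw [hη _ (u : 𝓞 K) (span_unit_ne_bot_and_isCoprime u) (by simp), integralRayClass_span_unit, map_one]

/-! ### §3 The class-group side: `Cl_K^𝔪 → Cl_K` -/

/-- **Every ideal class contains a nonzero integral ideal prime to `𝔪`** (`𝔪 ≠ 0`): for `[𝔟] = C⁻¹` write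
`𝔪𝔟 + (a) = 𝔟` (`IsDedekindDomain.exists_sup_span_eq`); then `(a) = 𝔟𝔞` with `𝔞 + 𝔪 = (1)` and `[𝔞] = C`.
[cite: NeukirchANT1999, Ch. VI §1 Exercise 13] -/
theorem exists_coprimeIdeal_idealClass_eq (h𝔪 : 𝔪 ≠ ⊥) (C : ClassGroup (𝓞 K)) :
    ∃ 𝔞 : CoprimeIdeal 𝔪, 𝔞.idealClass = C := by
  by_cases htop : 𝔪 = ⊤
  · obtain ⟨⟨I, hImem⟩, hI⟩ := ClassGroup.mk0_surjective C
    have hI0 : I ≠ ⊥ := nonZeroDivisors.ne_zero hImem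
    refine ⟨⟨I, hI0, ?_⟩, hI⟩
    rw [htop, ← Ideal.one_eq_top]
    exact isCoprime_one_right
  obtain ⟨⟨I, hImem⟩, hI⟩ := ClassGroup.mk0_surjective C⁻¹
  have hI0 : I ≠ ⊥ := nonZeroDivisors.ne_zero hImem
  obtain ⟨a, ha⟩ := IsDedekindDomain.exists_sup_span_eq (I := 𝔪 * I) (J := I) Ideal.mul_le_left
    (mul_ne_zero h𝔪 hI0)
  have haI : Ideal.span {a} ≤ I := le_sup_right.trans ha.le
  obtain ⟨𝔞, h𝔞⟩ := Ideal.dvd_iff_le.mpr haI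
  have hsup : 𝔪 ⊔ 𝔞 = ⊤ := by
    have e : I * (𝔪 ⊔ 𝔞) = I * ⊤ := by
      rw [Ideal.mul_sup, Ideal.mul_top, ← h𝔞, mul_comm, ha]
    exact mul_left_cancel₀ hI0 e
  have h𝔞0 : 𝔞 ≠ ⊥ := by
    rintro rfl
    apply htop
    rw [Ideal.mul_bot] at h𝔞
    rw [h𝔞, sup_bot_eq] at ha
    have e : 𝔪 * I = 1 * I := by rw [ha, one_mul]
    rw [← Ideal.one_eq_top]
    exact mul_right_cancel₀ hI0 e
  have ha0 : a ≠ 0 := by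
    rintro rfl
    rw [Ideal.span_singleton_eq_bot.mpr rfl, eq_comm, Ideal.mul_eq_bot] at h𝔞
    exact h𝔞.elim hI0 h𝔞0
  refine ⟨⟨𝔞, h𝔞0, Ideal.isCoprime_iff_sup_eq.mpr (by rwa [sup_comm])⟩, ?_⟩
  rw [← inv_inv C, ← hI, CoprimeIdeal.idealClass]
  refine ClassGroup.mk0_eq_mk0_inv_iff.mpr ⟨a, ha0, ?_⟩
  change 𝔞 * I = Ideal.span {a}
  rw [mul_comm, ← h𝔞]

/-- **Same ideal class ⟹ same value under a character of `Cl_K^𝔪` killing the principal classes `[(a)]`.**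
(`(x)𝔞 = (y)𝔟` with `x, y` prime to `𝔪`, `exists_coprime_span_mul_eq`.) [cite: NeukirchANT1999, Ch. VI §1 Prop. (1.11)] -/
theorem apply_integralRayClass_eq_of_idealClass_eq (h𝔪 : 𝔪 ≠ ⊥) {G : Type*} [CommGroup G] (ψ : RayClassGroup 𝔪 →* G)
    (hψ : ∀ (a : 𝓞 K) (ha : Ideal.span {a} ≠ ⊥ ∧ IsCoprime (Ideal.span {a}) 𝔪),
      ψ (integralRayClass 𝔪 h𝔪 ⟨Ideal.span {a}, ha⟩) = 1)
    {𝔞 𝔟 : CoprimeIdeal 𝔪} (h : 𝔞.idealClass = 𝔟.idealClass) :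
    ψ (integralRayClass 𝔪 h𝔪 𝔞) = ψ (integralRayClass 𝔪 h𝔪 𝔟) := by
  obtain ⟨x, y, hx, hy, hxc, hyc, heq⟩ := exists_coprime_span_mul_eq 𝔞.2.1 𝔟.2.1 𝔞.2.2 𝔟.2.2 h
  have hx' : Ideal.span {x} ≠ ⊥ ∧ IsCoprime (Ideal.span {x}) 𝔪 := ⟨mt Ideal.span_singleton_eq_bot.mp hx, hxc⟩
  have hy' : Ideal.span {y} ≠ ⊥ ∧ IsCoprime (Ideal.span {y}) 𝔪 := ⟨mt Ideal.span_singleton_eq_bot.mp hy, hyc⟩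
  have h3 : integralRayClass 𝔪 h𝔪 ⟨Ideal.span {x} * 𝔞.1, mul_ne_bot_and_isCoprime ⟨_, hx'⟩ 𝔞⟩ =
      integralRayClass 𝔪 h𝔪 ⟨Ideal.span {y} * 𝔟.1, mul_ne_bot_and_isCoprime ⟨_, hy'⟩ 𝔟⟩ :=
    integralRayClass_congr h𝔪 heq
  have h4 := congrArg ψ h3
  rwa [integralRayClass_mul h𝔪 ⟨_, hx'⟩ 𝔞, integralRayClass_mul h𝔪 ⟨_, hy'⟩ 𝔟, map_mul, map_mul, hψ, hψ, one_mul,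
    one_mul] at h4

/-- **Dévissage, class-group side: a character of `Cl_K^𝔪` killing every `[(a)]` (`a` prime to `𝔪`) factors through the
class group** — `ψ [𝔞] = ψ' (cl 𝔞)` for a (unique) `ψ' : Cl_K →* G`. [cite: NeukirchANT1999, Ch. VI §1 Prop. (1.11)] -/
theorem exists_classGroup_hom_of_forall_span (h𝔪 : 𝔪 ≠ ⊥) {G : Type*} [CommGroup G] (ψ : RayClassGroup 𝔪 →* G)
    (hψ : ∀ (a : 𝓞 K) (ha : Ideal.span {a} ≠ ⊥ ∧ IsCoprime (Ideal.span {a}) 𝔪),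
      ψ (integralRayClass 𝔪 h𝔪 ⟨Ideal.span {a}, ha⟩) = 1) :
    ∃ ψ' : ClassGroup (𝓞 K) →* G, ∀ 𝔞 : CoprimeIdeal 𝔪, ψ (integralRayClass 𝔪 h𝔪 𝔞) = ψ' 𝔞.idealClass := by
  choose rep hrep using exists_coprimeIdeal_idealClass_eq (K := K) h𝔪
  have hmulclass : ∀ C D : ClassGroup (𝓞 K),
      (rep (C * D)).idealClass = CoprimeIdeal.idealClass ⟨(rep C).1 * (rep D).1, mul_ne_bot_and_isCoprime _ _⟩ := by
    intro C D
    rw [hrep]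
    change C * D = ClassGroup.mk0 ⟨(rep C).1 * (rep D).1, _⟩
    conv_lhs => rw [← hrep C, ← hrep D]
    exact (map_mul ClassGroup.mk0 _ _).symm
  refine ⟨MonoidHom.mk' (fun C => ψ (integralRayClass 𝔪 h𝔪 (rep C))) fun C D => ?_, fun 𝔞 => ?_⟩
  · rw [← map_mul, ← integralRayClass_mul h𝔪 (rep C) (rep D) (mul_ne_bot_and_isCoprime _ _)]
    exact apply_integralRayClass_eq_of_idealClass_eq h𝔪 ψ hψ (hmulclass C D)
  · rw [MonoidHom.mk'_apply]
    exact apply_integralRayClass_eq_of_idealClass_eq h𝔪 ψ hψ (hrep _).symm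

/-- Converse: a character that factors through the class group kills every `[(a)]`. [folklore] -/
theorem apply_integralRayClass_span_eq_one_of_classGroup_hom (h𝔪 : 𝔪 ≠ ⊥) {G : Type*} [CommGroup G]
    (ψ : RayClassGroup 𝔪 →* G) (ψ' : ClassGroup (𝓞 K) →* G)
    (h : ∀ 𝔞 : CoprimeIdeal 𝔪, ψ (integralRayClass 𝔪 h𝔪 𝔞) = ψ' 𝔞.idealClass)
    (a : 𝓞 K) (ha : Ideal.span {a} ≠ ⊥ ∧ IsCoprime (Ideal.span {a}) 𝔪) :
    ψ (integralRayClass 𝔪 h𝔪 ⟨Ideal.span {a}, ha⟩) = 1 := by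
  rw [h, CoprimeIdeal.idealClass]
  change ψ' (ClassGroup.mk0 ⟨Ideal.span {a}, _⟩) = 1
  rw [(ClassGroup.mk0_eq_one_iff _).mpr inferInstance, map_one]

/-- A character of `Cl_K^𝔪` is determined by its values on the classes of integral ideals prime to `𝔪`. [folklore] -/
theorem eq_one_of_forall_integralRayClass (h𝔪 : 𝔪 ≠ ⊥) {G : Type*} [CommGroup G] (ψ : RayClassGroup 𝔪 →* G)
    (h : ∀ 𝔞 : CoprimeIdeal 𝔪, ψ (integralRayClass 𝔪 h𝔪 𝔞) = 1) : ψ = 1 := by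
  refine MonoidHom.ext fun c => ?_
  obtain ⟨𝔞, rfl⟩ := integralRayClass_surjective h𝔪 c
  rw [h, MonoidHom.one_apply]

/-- **THE DÉVISSAGE (dual form of `(𝓞/𝔪)ˣ → Cl_K^𝔪 → Cl_K → 1`, totally complex `K`)**: a character `ψ` of `Cl_K^𝔪` is
trivial as soon as (i) the character `a mod 𝔪 ↦ ψ [(a)]` of `(𝓞 K/𝔪)ˣ` it induces is trivial and (ii) every character of
`Cl_K` through which it then factors is trivial. [cite: NeukirchANT1999, Ch. VI §1 Prop. (1.11)] -/
theorem eq_one_of_unitsQuot_of_classGroup [IsTotallyComplex K] (h𝔪 : 𝔪 ≠ ⊥) {G : Type*} [CommGroup G]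
    (ψ : RayClassGroup 𝔪 →* G)
    (hunits : ∀ η : (𝓞 K ⧸ 𝔪)ˣ →* G,
      (∀ (x : (𝓞 K ⧸ 𝔪)ˣ) (a : 𝓞 K) (ha : Ideal.span {a} ≠ ⊥ ∧ IsCoprime (Ideal.span {a}) 𝔪),
        Ideal.Quotient.mk 𝔪 a = x → η x = ψ (integralRayClass 𝔪 h𝔪 ⟨Ideal.span {a}, ha⟩)) → η = 1)
    (hclass : ∀ ψ' : ClassGroup (𝓞 K) →* G,
      (∀ 𝔞 : CoprimeIdeal 𝔪, ψ (integralRayClass 𝔪 h𝔪 𝔞) = ψ' 𝔞.idealClass) → ψ' = 1) :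
    ψ = 1 := by
  obtain ⟨η, hη⟩ := exists_unitsQuot_character h𝔪 ψ
  have hη1 := hunits η hη
  have hψ : ∀ (a : 𝓞 K) (ha : Ideal.span {a} ≠ ⊥ ∧ IsCoprime (Ideal.span {a}) 𝔪),
      ψ (integralRayClass 𝔪 h𝔪 ⟨Ideal.span {a}, ha⟩) = 1 := by
    intro a ha
    have hu : IsUnit (Ideal.Quotient.mk 𝔪 a) := (isCoprime_span_singleton_iff_isUnit_mk a).mp ha.2
    rw [← hη hu.unit a ha hu.unit_spec, hη1, MonoidHom.one_apply]
  obtain ⟨ψ', hψ'⟩ := exists_classGroup_hom_of_forall_span h𝔪 ψ hψ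
  have h1 := hclass ψ' hψ'
  exact eq_one_of_forall_integralRayClass h𝔪 ψ fun 𝔞 => by rw [hψ', h1, MonoidHom.one_apply]


end Summit.BirchSwinnertonDyer.BirchSwinnertonDyer.Theorems.PrintCFram.HerbrandRayClassDevissage

end
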